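import Mathlib
import Summits.ValiantsHypothesis.ValiantsHypothesis.Theorems.TwoAdicLadderCeilingAllPrecisions
import Summits.ValiantsHypothesis.ValiantsHypothesis.Theorems.TwoAdicLadderPrecisionLadderDescentBoundedRank
import Literature.Computability.AlgebraicComplexity.RazElusiveGeneralRouteProofs
import Literature.Computability.AlgebraicComplexity.StandardFamilies
import HarnessLib

/-!
# ValiantsHypothesis / TwoAdicLadder — crux `PrecisionLadder` (stmt-ValiantsHypothesis-5948),
# line `Cruxes/PrecisionLadder/Lines/birth.lean`, registered stub `stub_descent`:
# the BOUNDED-PRECISION SLICE and the reduction of the stub to its residual core (helper)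

The registered stub `stub_descent` asks, for every `c`, for a `c'` such that for all large `n`,
EVERY precision `k` and EVERY finite chain ring `S` (finite local principal ideal ring) of
characteristic `2^(k+1)`:  `L_S(per_n) ≤ n^c ⇒ L_{ℤ/2^(k+1)}(per_n) ≤ n^{c'}`.

Two slices of it are theorems of the tree after this file:

* **bounded rank** (`stub_descent_slice`, file `TwoAdicLadderPrecisionLadderDescentBoundedRank`):
  `S` generated additively by `≤ n^a` elements, any `k`; `c' = c + 3a + 4`
  (Hrubeš–Yehudayoff structure-constant simulation);
* **bounded precision** (`stub_descent_boundedPrecision`, THIS file): `k ≤ K`, any `S` — here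
  the conclusion holds OUTRIGHT, with `c'` depending on `K` only, because the route's support item
  `CeilingAllPrecisions` is PROVED in the tree (`TwoAdicLadder.ceilingAllPrecisions_proof`: for
  every `K` the permanent is p-computable over `ℤ/2^K`, size `n^{O(K)}`, by the identity
  `per_n = Σ_{j<K} (−2)^j J_j` with `J_j` sums of pinned determinants), transported down to every
  precision `j ≤ K + 1` along the reduction maps `ZMod (2^(K+1)) →+* ZMod (2^j)`
  (`complexity_map_le`, `map_perPoly`).  In particular the case `k = 0` of the stub's docstring
  ("trivially true in characteristic 2, per = det") is the instance `K = 0`.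

`stub_descent_of_core` then PROVES the registered stub from its residual core: the same
implication restricted to precisions `k > K` AND chain rings `S` that are NOT generated additively
by `n^a` elements (residue degree × ramification super-polynomial in `n`), for any one pair
`(K, a)`.  That core — "high 2-adic precision together with huge chain rings does not help the
permanent super-polynomially" — is the ENTIRE open content of `stub_descent`; it is a
constant-elimination statement over a non-closed base ring (no descent polynomial in `log f` is
known even for `𝔽_{2^f}` versus `𝔽₂` constants), it is NOT proved here, and `stub_descent`,
`stub_ladderZ` and the crux `TwoAdicLadder.PrecisionLadder` remain OPEN.  `VP ≠ VNP` is NOT proved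
and nothing in this file is progress on it.  Helper file: no definitions, no named facts.
-/

-- `Summit.ValiantsHypothesis.ValiantsHypothesis.…` is the tree's mandated single-conjunct layout
-- (Sub = Summit), so the duplicated namespace component is intended.
set_option linter.dupNamespace false

namespace Summit.ValiantsHypothesis.ValiantsHypothesis.Theorems.TwoAdicLadderPrecisionLadder

open Literature.Computability.AlgebraicComplexity

/-- **Precision monotonicity.**  If `m ∣ M` then `L_{ℤ/m}(per_n) ≤ L_{ℤ/M}(per_n)`: push a
circuit along the reduction map `ZMod M →+* ZMod m` (extension of scalars is free,
`ArithCircuit.complexity_map_le`; `map_perPoly`). [folklore] -/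
theorem complexity_perPoly_zmod_le_of_dvd {m M : ℕ} (h : m ∣ M) (n : ℕ) :
    complexity (perPoly (Fin n) (ZMod m)) ≤ complexity (perPoly (Fin n) (ZMod M)) := by
  have hle := ArithCircuit.complexity_map_le (ZMod.castHom h (ZMod m)) (perPoly (Fin n) (ZMod M))
  rwa [map_perPoly] at hle

/-- A p-bounded quantity is eventually below one fixed power: `t ≤ n ^ c + c ⇒ t ≤ n ^ (c + 1)`
for `n ≥ 2`. [folklore] -/
theorem pow_add_self_le_pow_succ {n c : ℕ} (hn : 2 ≤ n) : n ^ c + c ≤ n ^ (c + 1) := by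
  have hc : c ≤ n ^ c :=
    (Nat.lt_two_pow_self).le.trans (Nat.pow_le_pow_left hn c)
  calc n ^ c + c ≤ n ^ c + n ^ c := Nat.add_le_add_left hc _
    _ = 2 * n ^ c := by ring
    _ ≤ n * n ^ c := Nat.mul_le_mul_right _ hn
    _ = n ^ (c + 1) := by ring

/-- **The ceiling at bounded precision, as one exponent.**  For every `K` there is `c'` with
`L_{ℤ/2^j}(per_n) ≤ n^{c'}` for all `n ≥ 2` and all precisions `j ≤ K + 1` — the tree's PROVED
support item `CeilingAllPrecisions` (`TwoAdicLadder.ceilingAllPrecisions_proof`, Valiant's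
`n^{O(K)}` algorithm in algebraic form) at precision `K + 1`, transported to `j ≤ K + 1` by
`complexity_perPoly_zmod_le_of_dvd`. [folklore] -/
theorem exists_pow_bound_perPoly_zmod_two_pow (K : ℕ) :
    ∃ c' : ℕ, ∀ n : ℕ, 2 ≤ n → ∀ j : ℕ, j ≤ K + 1 →
      complexity (perPoly (Fin n) (ZMod (2 ^ j))) ≤ n ^ c' := by
  have hceil := Summit.ValiantsHypothesis.ValiantsHypothesis.Theorems.TwoAdicLadder.ceilingAllPrecisions_proof
  unfold Summit.ValiantsHypothesis.ValiantsHypothesis.Theses.TwoAdicLadder.CeilingAllPrecisions at hceil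
  obtain ⟨c, hc⟩ := hceil (K + 1)
  refine ⟨c + 1, fun n hn j hj => ?_⟩
  calc complexity (perPoly (Fin n) (ZMod (2 ^ j)))
      ≤ complexity (perPoly (Fin n) (ZMod (2 ^ (K + 1)))) :=
        complexity_perPoly_zmod_le_of_dvd (Nat.pow_dvd_pow 2 hj) n
    _ ≤ n ^ c + c := hc n
    _ ≤ n ^ (c + 1) := pow_add_self_le_pow_succ hn

/-- **The bounded-precision slice of `stub_descent`.**  In the literal quantifier shape of the
registered stub (`Cruxes/PrecisionLadder/Lines/birth.lean`, `Stmt.stub_descent`) with ONE inserted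
hypothesis, `k ≤ K`: for precisions `k ≤ K` the conclusion `L_{ℤ/2^(k+1)}(per_n) ≤ n^{c'}` holds
OUTRIGHT for all `n ≥ 2` (the ceiling `CeilingAllPrecisions` is proved), for every chain ring `S`
and independently of the hypothesis `L_S(per_n) ≤ n^c`; `c'` depends on `K` only.  The instance
`K = 0` is the "characteristic 2, per = det" case of the stub's docstring.  The registered stub
(all precisions, uniformly) stays OPEN. [folklore] -/
theorem stub_descent_boundedPrecision (K : ℕ) :
    ∀ c : ℕ, ∃ c' : ℕ, ∀ᶠ n in Filter.atTop, ∀ (k : ℕ) (S : Type) [CommRing S] [Fintype S],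
      IsLocalRing S → IsPrincipalIdealRing S → CharP S (2 ^ (k + 1)) →
      k ≤ K →
      complexity (perPoly (Fin n) S) ≤ n ^ c →
      complexity (perPoly (Fin n) (ZMod (2 ^ (k + 1)))) ≤ n ^ c' := by
  intro c
  obtain ⟨c', hc'⟩ := exists_pow_bound_perPoly_zmod_two_pow K
  refine ⟨c', ?_⟩
  filter_upwards [Filter.eventually_ge_atTop 2] with n hn
  intro k S _ _ _ _ _ hk _
  exact hc' n hn (k + 1) (Nat.succ_le_succ hk)

/-- **`stub_descent` from its residual core.**  Fix any `K a : ℕ`.  If descent with polynomial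
overhead holds for all large `n` at all precisions `k > K` over all finite chain rings `S` of
characteristic `2^(k+1)` that are NOT generated additively by `n^a` elements (the CORE: high
precision together with residue degree × ramification super-polynomial in `n`), then the registered
stub `stub_descent` holds verbatim: precisions `k ≤ K` are the bounded-precision slice
(`stub_descent_boundedPrecision`, unconditional), chain rings with `≤ n^a` additive generators are
the bounded-rank slice (`stub_descent_slice`, Hrubeš–Yehudayoff simulation, `c' = c + 3a + 4`), and
the three exponents are merged by `max`.  The core itself is NOT proved anywhere (open:
"big chain rings do not help the permanent"); this theorem only localises the open content of the
stub. [folklore] -/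
theorem stub_descent_of_core (K a : ℕ)
    (hcore : ∀ c : ℕ, ∃ c' : ℕ, ∀ᶠ n in Filter.atTop, ∀ (k : ℕ) (S : Type) [CommRing S] [Fintype S],
      IsLocalRing S → IsPrincipalIdealRing S → CharP S (2 ^ (k + 1)) →
      K < k →
      (¬ ∃ s : Fin (n ^ a) → S, AddSubgroup.closure (Set.range s) = ⊤) →
      complexity (perPoly (Fin n) S) ≤ n ^ c →
      complexity (perPoly (Fin n) (ZMod (2 ^ (k + 1)))) ≤ n ^ c') :
    ∀ c : ℕ, ∃ c' : ℕ, ∀ᶠ n in Filter.atTop, ∀ (k : ℕ) (S : Type) [CommRing S] [Fintype S],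
      IsLocalRing S → IsPrincipalIdealRing S → CharP S (2 ^ (k + 1)) →
      complexity (perPoly (Fin n) S) ≤ n ^ c →
      complexity (perPoly (Fin n) (ZMod (2 ^ (k + 1)))) ≤ n ^ c' := by
  intro c
  obtain ⟨c₁, h₁⟩ := hcore c
  obtain ⟨c₂, h₂⟩ := stub_descent_slice a c
  obtain ⟨c₃, h₃⟩ := stub_descent_boundedPrecision K c
  refine ⟨max c₁ (max c₂ c₃), ?_⟩
  filter_upwards [h₁, h₂, h₃, Filter.eventually_ge_atTop 1] with n hn₁ hn₂ hn₃ hn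
  intro k S _ _ hloc hPIR hchar hL
  have mono : ∀ {d : ℕ}, d ≤ max c₁ (max c₂ c₃) →
      complexity (perPoly (Fin n) (ZMod (2 ^ (k + 1)))) ≤ n ^ d →
      complexity (perPoly (Fin n) (ZMod (2 ^ (k + 1)))) ≤ n ^ max c₁ (max c₂ c₃) :=
    fun hd h => h.trans (Nat.pow_le_pow_right hn hd)
  by_cases hk : k ≤ K
  · exact mono (le_max_of_le_right (le_max_right _ _)) (hn₃ k S hloc hPIR hchar hk hL)
  · by_cases hgen : ∃ s : Fin (n ^ a) → S, AddSubgroup.closure (Set.range s) = ⊤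
    · exact mono (le_max_of_le_right (le_max_left _ _)) (hn₂ k S hloc hPIR hchar hgen hL)
    · exact mono (le_max_left _ _) (hn₁ k S hloc hPIR hchar (not_le.mp hk) hgen hL)


/-! ## Small rings: the cardinality form of the bounded-rank slice -/

/-- A finite additive commutative group of order at most `2 ^ N` is generated by `N` elements:
a nonzero `x` generates a subgroup of order `≥ 2`, the quotient has order `≤ 2 ^ (N - 1)`, and
generators of the quotient lift (induction on `N`; "each new generator at least doubles the
subgroup", Lagrange). [folklore] -/
theorem exists_generators_of_card_le_two_pow :
    ∀ (N : ℕ) (M : Type*) [AddCommGroup M] [Finite M], Nat.card M ≤ 2 ^ N →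
      ∃ s : Fin N → M, AddSubgroup.closure (Set.range s) = ⊤ := by
  intro N
  induction N with
  | zero =>
    intro M _ _ hM
    haveI : Subsingleton M := Finite.card_le_one_iff_subsingleton.mp (by simpa using hM)
    exact ⟨Fin.elim0, Subsingleton.elim _ _⟩
  | succ N ih =>
    intro M _ _ hM
    by_cases hsub : Subsingleton M
    · exact ⟨fun _ => 0, Subsingleton.elim _ _⟩
    · -- a nonzero element and the cyclic subgroup it generates
      obtain ⟨x, hx⟩ : ∃ x : M, x ≠ 0 := by
        by_contra h
        push Not at h
        exact hsub ⟨fun a b => by rw [h a, h b]⟩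
      set H : AddSubgroup M := AddSubgroup.zmultiples x with hH
      have hHcard : 2 ≤ Nat.card H := by
        have hnt : Nontrivial H := ⟨⟨⟨x, AddSubgroup.mem_zmultiples x⟩, 0, by
          intro h0
          exact hx (by simpa using congrArg Subtype.val h0)⟩⟩
        exact Finite.one_lt_card_iff_nontrivial.mpr hnt
      -- the quotient has order `≤ 2 ^ N`
      have hQ : Nat.card (M ⧸ H) ≤ 2 ^ N := by
        have hmul : Nat.card M = Nat.card (M ⧸ H) * Nat.card H :=
          AddSubgroup.card_eq_card_quotient_mul_card_addSubgroup H
        have h2 : Nat.card (M ⧸ H) * 2 ≤ 2 ^ N * 2 := by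
          calc Nat.card (M ⧸ H) * 2 ≤ Nat.card (M ⧸ H) * Nat.card H :=
                Nat.mul_le_mul_left _ hHcard
            _ = Nat.card M := hmul.symm
            _ ≤ 2 ^ (N + 1) := hM
            _ = 2 ^ N * 2 := by ring
        exact Nat.le_of_mul_le_mul_right h2 (by norm_num)
      obtain ⟨t, ht⟩ := ih (M ⧸ H) hQ
      -- lift the generators of the quotient and add `x`
      refine ⟨Fin.cons x (fun i => Quotient.out (t i)), ?_⟩
      rw [eq_top_iff]
      intro m _
      set K : AddSubgroup M :=
        AddSubgroup.closure (Set.range (Fin.cons x (fun i => Quotient.out (t i)) : Fin (N + 1) → M))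
        with hK
      have hxK : x ∈ K := AddSubgroup.subset_closure ⟨0, rfl⟩
      have hHK : H ≤ K := by
        rw [hH, AddSubgroup.zmultiples_le]
        exact hxK
      have hliftK : ∀ i, Quotient.out (t i) ∈ K := fun i =>
        AddSubgroup.subset_closure ⟨i.succ, by simp⟩
      -- the image of `K` in the quotient is everything
      have hmK : (QuotientAddGroup.mk m : M ⧸ H) ∈ K.map (QuotientAddGroup.mk' H) := by
        have htop : (QuotientAddGroup.mk m : M ⧸ H) ∈ AddSubgroup.closure (Set.range t) := by
          rw [ht]; trivial
        have hle : AddSubgroup.closure (Set.range t) ≤ K.map (QuotientAddGroup.mk' H) := by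
          rw [AddSubgroup.closure_le]
          rintro _ ⟨i, rfl⟩
          refine ⟨Quotient.out (t i), hliftK i, ?_⟩
          simp
        exact hle htop
      obtain ⟨m', hm'K, hm'⟩ := hmK
      have hdiff : m - m' ∈ H := by
        rw [← QuotientAddGroup.eq_iff_sub_mem]
        simpa using hm'.symm
      have : m = (m - m') + m' := by abel
      rw [this]
      exact K.add_mem (hHK hdiff) hm'K

/-- **The small-ring slice of `stub_descent` (cardinality form).**  In the quantifier shape of the
registered stub with ONE inserted hypothesis, `Fintype.card S ≤ 2 ^ (n ^ a)`: a finite ring of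
order `≤ 2^(n^a)` is generated additively by `n^a` elements
(`exists_generators_of_card_le_two_pow`), so the bounded-rank slice `stub_descent_slice`
(Hrubeš–Yehudayoff simulation) applies; `c' = c + 3a + 4`.  Since `|S| ≥ 2^(k+1)` for a ring of
characteristic `2^(k+1)`, this slice only speaks about precisions `k < n^a`; chain rings of order
`> 2^{poly(n)}` are the open core.  The registered stub stays OPEN. [folklore] -/
theorem stub_descent_of_card_le (a : ℕ) :
    ∀ c : ℕ, ∃ c' : ℕ, ∀ᶠ n in Filter.atTop, ∀ (k : ℕ) (S : Type) [CommRing S] [Fintype S],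
      IsLocalRing S → IsPrincipalIdealRing S → CharP S (2 ^ (k + 1)) →
      Fintype.card S ≤ 2 ^ (n ^ a) →
      complexity (perPoly (Fin n) S) ≤ n ^ c →
      complexity (perPoly (Fin n) (ZMod (2 ^ (k + 1)))) ≤ n ^ c' := by
  intro c
  obtain ⟨c', hc'⟩ := stub_descent_slice a c
  refine ⟨c', ?_⟩
  filter_upwards [hc'] with n hn
  intro k S _ _ hloc hPIR hchar hcard hL
  refine hn k S hloc hPIR hchar ?_ hL
  have hcard' : Nat.card S ≤ 2 ^ (n ^ a) := by rwa [Nat.card_eq_fintype_card]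
  exact exists_generators_of_card_le_two_pow (n ^ a) S hcard'

/-! ## The residual core is exactly the open content: `stub_descent ↔ ∃ K a, core K a` -/

/-- **`stub_descent` from the EXISTENCE of one settled core.**  If for SOME thresholds `K a` the
core implication holds (precisions `k > K`, chain rings NOT generated additively by `n^a`
elements), the registered stub holds (`stub_descent_of_core`).  This is the register-ready
reshaped form of the stub: `∃ K a, core K a`. [folklore] -/
theorem stub_descent_of_exists_core
    (hcore : ∃ K a : ℕ, ∀ c : ℕ, ∃ c' : ℕ, ∀ᶠ n in Filter.atTop,
      ∀ (k : ℕ) (S : Type) [CommRing S] [Fintype S],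
      IsLocalRing S → IsPrincipalIdealRing S → CharP S (2 ^ (k + 1)) →
      K < k →
      (¬ ∃ s : Fin (n ^ a) → S, AddSubgroup.closure (Set.range s) = ⊤) →
      complexity (perPoly (Fin n) S) ≤ n ^ c →
      complexity (perPoly (Fin n) (ZMod (2 ^ (k + 1)))) ≤ n ^ c') :
    ∀ c : ℕ, ∃ c' : ℕ, ∀ᶠ n in Filter.atTop, ∀ (k : ℕ) (S : Type) [CommRing S] [Fintype S],
      IsLocalRing S → IsPrincipalIdealRing S → CharP S (2 ^ (k + 1)) →
      complexity (perPoly (Fin n) S) ≤ n ^ c →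
      complexity (perPoly (Fin n) (ZMod (2 ^ (k + 1)))) ≤ n ^ c' := by
  obtain ⟨K, a, h⟩ := hcore
  exact stub_descent_of_core K a h

/-- **Conversely, the registered stub contains every core** (the core has more hypotheses), so
`stub_descent` is EQUIVALENT to `∃ K a, core K a` (`stub_descent_iff_exists_core`): the two landed
slices lose nothing, and the core is exactly the open content of the stub. [folklore] -/
theorem core_of_stub_descent (K a : ℕ)
    (hdesc : ∀ c : ℕ, ∃ c' : ℕ, ∀ᶠ n in Filter.atTop,
      ∀ (k : ℕ) (S : Type) [CommRing S] [Fintype S],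
      IsLocalRing S → IsPrincipalIdealRing S → CharP S (2 ^ (k + 1)) →
      complexity (perPoly (Fin n) S) ≤ n ^ c →
      complexity (perPoly (Fin n) (ZMod (2 ^ (k + 1)))) ≤ n ^ c') :
    ∀ c : ℕ, ∃ c' : ℕ, ∀ᶠ n in Filter.atTop, ∀ (k : ℕ) (S : Type) [CommRing S] [Fintype S],
      IsLocalRing S → IsPrincipalIdealRing S → CharP S (2 ^ (k + 1)) →
      K < k →
      (¬ ∃ s : Fin (n ^ a) → S, AddSubgroup.closure (Set.range s) = ⊤) →
      complexity (perPoly (Fin n) S) ≤ n ^ c →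
      complexity (perPoly (Fin n) (ZMod (2 ^ (k + 1)))) ≤ n ^ c' := by
  intro c
  obtain ⟨c', hc'⟩ := hdesc c
  refine ⟨c', ?_⟩
  filter_upwards [hc'] with n hn
  intro k S _ _ hloc hPIR hchar _ _ hL
  exact hn k S hloc hPIR hchar hL

/-- **`stub_descent ↔ ∃ K a, core K a`**: the registered stub is equivalent to the existence of
thresholds `K a` beyond which (precision `k > K`, chain rings needing more than `n^a` additive
generators) descent with polynomial overhead holds — the bounded-precision slice
(`CeilingAllPrecisions`) and the bounded-rank slice (Hrubeš–Yehudayoff) cover the rest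
unconditionally.  Neither side is proved; this only pins down the open content. [folklore] -/
theorem stub_descent_iff_exists_core :
    (∀ c : ℕ, ∃ c' : ℕ, ∀ᶠ n in Filter.atTop, ∀ (k : ℕ) (S : Type) [CommRing S] [Fintype S],
      IsLocalRing S → IsPrincipalIdealRing S → CharP S (2 ^ (k + 1)) →
      complexity (perPoly (Fin n) S) ≤ n ^ c →
      complexity (perPoly (Fin n) (ZMod (2 ^ (k + 1)))) ≤ n ^ c') ↔
    (∃ K a : ℕ, ∀ c : ℕ, ∃ c' : ℕ, ∀ᶠ n in Filter.atTop,
      ∀ (k : ℕ) (S : Type) [CommRing S] [Fintype S],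
      IsLocalRing S → IsPrincipalIdealRing S → CharP S (2 ^ (k + 1)) →
      K < k →
      (¬ ∃ s : Fin (n ^ a) → S, AddSubgroup.closure (Set.range s) = ⊤) →
      complexity (perPoly (Fin n) S) ≤ n ^ c →
      complexity (perPoly (Fin n) (ZMod (2 ^ (k + 1)))) ≤ n ^ c') :=
  ⟨fun h => ⟨0, 0, core_of_stub_descent 0 0 h⟩, stub_descent_of_exists_core⟩

end Summit.ValiantsHypothesis.ValiantsHypothesis.Theorems.TwoAdicLadderPrecisionLadder
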